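import Literature.Probability.Percolation.CutBlocksFaces
import Literature.Probability.Percolation.StoppingSetCondExp
import HarnessLib

/-!
# Events of the explored data: the bad events are data events

Topic `Probability/Percolation`.  Support file (definitions and proofs, no named fact) for the named
fact `SchrammSmirnov2011_thm_1_7` (the data event `A` of the surrogate, proof of Prop. 4.1, Ann.
Probab. 39 (2011), §4, "given M and the restriction of ω to it").  A DATA EVENT of a collar datum is
an event that is a function of the explored data `𝒞.data ω = (examined edges, their states)`
(`DataEvent`).  Data events form a Boolean algebra, are determined by the finite set `𝒞.A` of
examinable edges, hence measurable (`DataEvent.measurableSet`), and belong to the explored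
`σ`-field `stoppedSigma G₀ N` of any stopping datum with `N ω ⊇ examined ω`
(`DataEvent.measurableSet_stoppedSigma`).  The bad patterns at a window (`patternOneAt`,
`patternTwoAt`), the corner events, the bad event of a face (`badFace`) and the total bad event
of compatible zones (`badAll`) are data events (`dataEvent_badAll`).

## References

* O. Schramm, S. Smirnov, *On the scaling limits of planar percolation*, Ann. Probab. 39 (2011)
  1768–1814, arXiv:1101.5820, §4, proof of Prop. 4.1 (p. 18). [SchrammSmirnov2011]
-/

noncomputable section

open MeasureTheory Set Finset
open Literature.Probability.LatticeModels
open scoped Classical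

namespace Literature.Probability.Percolation

namespace Seeded

namespace CollarDatum

variable (𝒞 : CollarDatum)

/-- **Data events**: events that are functions of the explored data. [cite: SchrammSmirnov2011, §4, proof of Prop. 4.1 (p. 18)] -/
def DataEvent (B : Set (BondConfig (Site 2))) : Prop :=
  ∀ ω ω' : BondConfig (Site 2), 𝒞.data ω' = 𝒞.data ω → (ω ∈ B ↔ ω' ∈ B)

variable {𝒞}

/-- Equal data means equal examined sets and agreement on the examined edges. [folklore] -/
theorem agree_of_data_eq {ω ω' : BondConfig (Site 2)} (h : 𝒞.data ω' = 𝒞.data ω) :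
    examined 𝒞.seeds ω' = examined 𝒞.seeds ω ∧ ∀ e ∈ examined 𝒞.seeds ω, (e ∈ ω ↔ e ∈ ω') := by
  have h1 : examined 𝒞.seeds ω' = examined 𝒞.seeds ω := congrArg Prod.fst h
  have h2 : obs ω' (examined 𝒞.seeds ω') = obs ω (examined 𝒞.seeds ω) := congrArg Prod.snd h
  refine ⟨h1, fun e he => ?_⟩
  have := Finset.ext_iff.1 h2 e
  rw [mem_obs_iff, mem_obs_iff, h1] at this
  tauto

/-- Agreement on the examined edges of one configuration gives equal data. [folklore] -/
theorem data_eq_of_agree {ω ω' : BondConfig (Site 2)} (h : ∀ e ∈ examined 𝒞.seeds ω, (e ∈ ω ↔ e ∈ ω')) :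
    𝒞.data ω' = 𝒞.data ω := by
  refine 𝒞.data_eq_of_inter_eq (Set.ext fun e => ?_)
  simp only [Set.mem_inter_iff, Finset.mem_coe]
  constructor
  · rintro ⟨he, hx⟩; exact ⟨(h e hx).1 he, hx⟩
  · rintro ⟨he, hx⟩; exact ⟨(h e hx).2 he, hx⟩

namespace DataEvent

/-- Complements of data events. [folklore] -/
theorem compl {B : Set (BondConfig (Site 2))} (h : 𝒞.DataEvent B) : 𝒞.DataEvent Bᶜ :=
  fun ω ω' hd => not_congr (h ω ω' hd)

/-- Unions of data events. [folklore] -/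
theorem union {B B' : Set (BondConfig (Site 2))} (h : 𝒞.DataEvent B) (h' : 𝒞.DataEvent B') : 𝒞.DataEvent (B ∪ B') :=
  fun ω ω' hd => or_congr (h ω ω' hd) (h' ω ω' hd)

/-- Finite unions of data events. [folklore] -/
theorem biUnion {ι : Type*} {I : Finset ι} {B : ι → Set (BondConfig (Site 2))} (h : ∀ i ∈ I, 𝒞.DataEvent (B i)) :
    𝒞.DataEvent (⋃ i ∈ I, B i) := fun ω ω' hd => by
  simp only [Set.mem_iUnion, exists_prop]
  exact exists_congr fun i => and_congr_right fun hi => h i hi ω ω' hd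

/-- **Data events are determined by the examinable edges.** [folklore] -/
theorem determinedBy {B : Set (BondConfig (Site 2))} (h : 𝒞.DataEvent B) : DeterminedBy B (↑𝒞.A : Set (Sym2 (Site 2))) := by
  rw [determinedBy_iff]
  intro ω ω' hag
  refine h ω ω' (data_eq_of_agree fun e he => ?_)
  have hA : e ∈ 𝒞.A := examined_subset (𝔖 := 𝒞.seeds) ω he
  have := Set.ext_iff.1 hag e
  simp only [Set.mem_inter_iff, Finset.mem_coe, hA, and_true] at this
  exact this

/-- **Data events are measurable.** [folklore] -/
theorem measurableSet {B : Set (BondConfig (Site 2))} (h : 𝒞.DataEvent B) : MeasurableSet B :=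
  h.determinedBy.measurableSet_of_finset

/-- **Data events are events of the explored `σ`-field** of any stopping datum revealing the examined
edges. [cite: SchrammSmirnov2011, §4, proof of Prop. 4.1 (p. 18)] -/
theorem measurableSet_stoppedSigma {B : Set (BondConfig (Site 2))} (h : 𝒞.DataEvent B)
    {G₀ : Finset (Sym2 (Site 2))} {N : BondConfig (Site 2) → Finset (Sym2 (Site 2))}
    (hN : ∀ ω, examined 𝒞.seeds ω ⊆ N ω) : MeasurableSet[stoppedSigma G₀ N] B := by
  refine ⟨h.measurableSet, fun ω ω' hag => h ω ω' (data_eq_of_agree fun e he => hag e (Or.inl (hN ω he)))⟩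

end DataEvent

/-! ### The pattern and corner events are data events -/

/-- The transported data is a function of the data. [folklore] -/
theorem map_data_eq_of_data_eq (ψ : LatticeSym) {ω ω' : BondConfig (Site 2)} (h : 𝒞.data ω' = 𝒞.data ω) :
    (𝒞.map ψ).data (ψ.relabel ω') = (𝒞.map ψ).data (ψ.relabel ω) := by
  obtain ⟨hX, hag⟩ := agree_of_data_eq h
  refine data_eq_of_agree fun e he => ?_
  rw [map_seeds, ψ.examined_map] at he
  rw [Finset.mem_map_equiv] at he
  have h1 := hag _ he
  have e1 : ψ.edgeEquiv (ψ.edgeEquiv.symm e) = e := Equiv.apply_symm_apply _ _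
  rw [← e1, ψ.mem_relabel_iff, ψ.mem_relabel_iff]
  exact h1

/-- **The bad pattern (Q1) at a window is a data event.** [folklore] -/
theorem dataEvent_patternOneAt (ψ : LatticeSym) (j : ℤ) (m : ℕ) : 𝒞.DataEvent (𝒞.patternOneAt ψ j m) := by
  intro ω ω' hd
  simp only [patternOneAt, Set.mem_preimage, patternOne, Set.mem_setOf_eq, map_data_eq_of_data_eq ψ hd]

/-- **The bad pattern (Q2) at a window is a data event.** [folklore] -/
theorem dataEvent_patternTwoAt (ψ : LatticeSym) (j : ℤ) (m : ℕ) : 𝒞.DataEvent (𝒞.patternTwoAt ψ j m) := by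
  intro ω ω' hd
  simp only [patternTwoAt, Set.mem_preimage, patternTwo, Set.mem_setOf_eq, map_data_eq_of_data_eq ψ hd]

/-- Hub vertices of the transported terminal exploration are read off the data. [folklore] -/
theorem oReach_map_iff_of_data_eq (ψ : LatticeSym) {ω ω' : BondConfig (Site 2)} (h : 𝒞.data ω' = 𝒞.data ω) (v : Site 2) :
    OReach (𝒞.map ψ).seeds (examined (𝒞.map ψ).seeds (ψ.relabel ω)) (ψ.relabel ω) v ↔
      OReach (𝒞.map ψ).seeds (examined (𝒞.map ψ).seeds (ψ.relabel ω')) (ψ.relabel ω') v := by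
  obtain ⟨hX, hag⟩ := agree_of_data_eq (map_data_eq_of_data_eq ψ h)
  rw [hX]
  exact oReach_congr hag v

/-- **The corner event is a data event.** [folklore] -/
theorem dataEvent_cornerEvent (ψ : LatticeSym) (c : ℤ) (w₀ : ℕ) : 𝒞.DataEvent (𝒞.cornerEvent ψ c w₀) := by
  intro ω ω' hd
  simp only [cornerEvent, Set.mem_setOf_eq]
  exact exists_congr fun x => and_congr_right fun _ => oReach_map_iff_of_data_eq ψ hd _

/-- **The bad event of a face is a data event.** [folklore] -/
theorem dataEvent_badFace (ψ : LatticeSym) (a b : ℤ) (w₀ m : ℕ) : 𝒞.DataEvent (𝒞.badFace ψ a b w₀ m) := by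
  unfold badFace
  refine ((dataEvent_cornerEvent ψ a w₀).union (dataEvent_cornerEvent ψ b w₀)).union ?_
  exact DataEvent.biUnion fun i _ => (dataEvent_patternOneAt ψ _ m).union (dataEvent_patternTwoAt ψ _ m)

end CollarDatum

end Seeded

namespace CutBlocks

open Seeded Seeded.CollarDatum

variable {s : ℝ} {α : Set ℂ} {δ : ℝ}

/-- **The total bad event of compatible zones is a data event** of their collar datum. [cite: SchrammSmirnov2011, §4, proof of Prop. 4.1 (p. 18)] -/
theorem dataEvent_badAll (hs : 0 < s) (hα : Bornology.IsBounded α) (δ : ℝ) (𝒵 : Seeded.Zones) (w₀ m : ℕ) :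
    𝒵.collar.DataEvent (badAll hs hα δ 𝒵 w₀ m) := by
  unfold badAll
  exact (((DataEvent.biUnion fun z _ => dataEvent_badFace _ _ _ w₀ m).union
    (DataEvent.biUnion fun z _ => dataEvent_badFace _ _ _ w₀ m)).union
    (DataEvent.biUnion fun z _ => dataEvent_badFace _ _ _ w₀ m)).union
    (DataEvent.biUnion fun z _ => dataEvent_badFace _ _ _ w₀ m)

/-- **The total bad event is measurable.** [folklore] -/
theorem measurableSet_badAll (hs : 0 < s) (hα : Bornology.IsBounded α) (δ : ℝ) (𝒵 : Seeded.Zones) (w₀ m : ℕ) :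
    MeasurableSet (badAll hs hα δ 𝒵 w₀ m) :=
  (dataEvent_badAll hs hα δ 𝒵 w₀ m).measurableSet

/-- **The good event belongs to the explored `σ`-field** of any stopping datum revealing the examined
edges of the collar exploration. [cite: SchrammSmirnov2011, §4, proof of Prop. 4.1 (p. 18)] -/
theorem measurableSet_stoppedSigma_compl_badAll (hs : 0 < s) (hα : Bornology.IsBounded α) (δ : ℝ) (𝒵 : Seeded.Zones)
    (w₀ m : ℕ) {G₀ : Finset (Sym2 (Site 2))} {N : BondConfig (Site 2) → Finset (Sym2 (Site 2))}
    (hN : ∀ ω, examined 𝒵.collar.seeds ω ⊆ N ω) :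
    MeasurableSet[stoppedSigma G₀ N] (badAll hs hα δ 𝒵 w₀ m)ᶜ :=
  (dataEvent_badAll hs hα δ 𝒵 w₀ m).compl.measurableSet_stoppedSigma hN

end CutBlocks

end Literature.Probability.Percolation

end
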